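import Mathlib
import Literature.Analysis.Complex.LogSectorExtension

/-!
# Triage check (crux stmt-QuantumFields-9664): the Thales computation of the two "slot" cards

`boostPoint_mem_sectorRegion_iff` (card `two-mirror-lightcone-slots`, companion lemma; also the geometry
claimed in card `lightcone-sector-engine`): the light-cone coordinates `(u,u') = ((t+iσ)/√2, (t-iσ)/√2)` of the
Euclidean boost point `(ζ,β) = (t, iσ)` lie in the two-slot sector region `{Re u, Re u' > 0, |arg u|+|arg u'| < π/2}`
iff `|σ| < t` — the engine's output region reaches the boost points exactly up to the light cone (speed of light 1).
-/

noncomputable section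

open Complex Set
open Literature.Analysis.Complex

namespace TriageThales

theorem arg_eq_arctan_of_re_pos {z : ℂ} (hz : 0 < z.re) : Complex.arg z = Real.arctan (z.im / z.re) := by
  have h1 : |Complex.arg z| < Real.pi / 2 := Complex.abs_arg_lt_pi_div_two_iff.2 (Or.inl hz)
  rw [abs_lt] at h1
  rw [← Complex.tan_arg, Real.arctan_tan h1.1 h1.2]

/-- `|arctan x| < π/4 ↔ |x| < 1`. -/
theorem abs_arctan_lt_pi_div_four_iff (x : ℝ) : |Real.arctan x| < Real.pi / 4 ↔ |x| < 1 := by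
  constructor
  · intro h
    rw [abs_lt] at h ⊢
    constructor
    · by_contra hle
      push Not at hle
      have := Real.arctan_strictMono.monotone hle
      rw [Real.arctan_neg, Real.arctan_one] at this
      linarith [h.1]
    · by_contra hge
      push Not at hge
      have := Real.arctan_strictMono.monotone hge
      rw [Real.arctan_one] at this
      linarith [h.2]
  · intro h
    rw [abs_lt] at h ⊢
    have h1 := Real.arctan_strictMono h.2
    have h2 := Real.arctan_strictMono h.1
    rw [Real.arctan_one] at h1
    rw [Real.arctan_neg, Real.arctan_one] at h2
    exact ⟨h2, h1⟩

theorem boostPoint_mem_sectorRegion_iff (t σ : ℝ) (ht : 0 < t) :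
    (![((t : ℂ) + σ * I) / (Real.sqrt 2 : ℂ), ((t : ℂ) - σ * I) / (Real.sqrt 2 : ℂ)] ∈
        sectorRegion 1 (Real.pi / 2)) ↔ |σ| < t := by
  have hs : 0 < Real.sqrt 2 := Real.sqrt_pos.2 two_pos
  set u : ℂ := ((t : ℂ) + σ * I) / (Real.sqrt 2 : ℂ) with hu
  set u' : ℂ := ((t : ℂ) - σ * I) / (Real.sqrt 2 : ℂ) with hu'
  have hure : u.re = t / Real.sqrt 2 := by rw [hu, Complex.div_ofReal_re]; simp
  have huim : u.im = σ / Real.sqrt 2 := by rw [hu, Complex.div_ofReal_im]; simp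
  have hu're : u'.re = t / Real.sqrt 2 := by rw [hu', Complex.div_ofReal_re]; simp
  have hu'im : u'.im = (-σ) / Real.sqrt 2 := by rw [hu', Complex.div_ofReal_im]; simp
  have hupos : 0 < u.re := by rw [hure]; positivity
  have hu'pos : 0 < u'.re := by rw [hu're]; positivity
  have hq : σ / Real.sqrt 2 / (t / Real.sqrt 2) = σ / t := by
    field_simp
  have hq' : (-σ) / Real.sqrt 2 / (t / Real.sqrt 2) = -(σ / t) := by
    field_simp
  have hargu : Complex.arg u = Real.arctan (σ / t) := by
    rw [arg_eq_arctan_of_re_pos hupos, huim, hure, hq]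
  have hargu' : Complex.arg u' = -Real.arctan (σ / t) := by
    rw [arg_eq_arctan_of_re_pos hu'pos, hu'im, hu're, hq', Real.arctan_neg]
  have hmem : (![u, u'] ∈ sectorRegion 1 (Real.pi / 2)) ↔
      ((0 < u.re ∧ 0 < u'.re) ∧ |Complex.arg u| + |Complex.arg u'| < Real.pi / 2) := by
    show ((∀ j : Fin 2, 0 < ((![u, u'] : Fin 2 → ℂ) j).re) ∧
        ∑ j : Fin 2, |Complex.arg ((![u, u'] : Fin 2 → ℂ) j)| < Real.pi / 2) ↔ _
    rw [Fin.sum_univ_two, Fin.forall_fin_two]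
    simp
  rw [hmem, hargu, hargu', abs_neg, ← two_mul]
  constructor
  · rintro ⟨-, h⟩
    have h2 : |Real.arctan (σ / t)| < Real.pi / 4 := by linarith
    rw [abs_arctan_lt_pi_div_four_iff, abs_div, abs_of_pos ht, div_lt_one ht] at h2
    exact h2
  · intro h
    refine ⟨⟨hupos, hu'pos⟩, ?_⟩
    have h2 : |Real.arctan (σ / t)| < Real.pi / 4 := by
      rw [abs_arctan_lt_pi_div_four_iff, abs_div, abs_of_pos ht, div_lt_one ht]
      exact h
    linarith

end TriageThales
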